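import Mathlib
import Literature.Geometry.Symplectic.JHolomorphicMap
import Literature.Topology.PlaneTopology.WindingNumber
import Summits.SmoothPoincare4.SmoothPoincare4.Theorems.SullivanDualTameOrBrodyR4PencilDefs
import Summits.SmoothPoincare4.SmoothPoincare4.Theorems.SullivanDualTameOrBrodyR4ContinuityEstimates
import Summits.SmoothPoincare4.SmoothPoincare4.Theorems.SullivanDualTameOrBrodyR4HelperGeneralisedArgumentPrinciple

/-!
# Far members are flat (stub `helper_farMemberFlat`, line Sketch)

Crux `stmt-SmoothPoincare4-7826` (`TameOrBrodyR4`), line `Sketch`, skeleton v17, in the vocabulary of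
`Theorems/SullivanDualTameOrBrodyR4PencilDefs.lean`: `J` on `ℝ⁴` is standard (`= i` in the frame
`(P, Q)`) where `‖x‖ ≥ R`, and `u` is a normalised member of the pencil in direction `P`
(`IsPencilMember J R P Q b₀ u`) whose asymptotic value is FAR, `‖b₀‖ > R`. Then `u` IS the flat
plane `{Q = b₀}` in its linear parametrisation, `u ξ = eP ξ + eQ b₀` — softly, without positivity
of intersections or uniqueness of members:

* `q := Q ∘ u` is continuous, tends to `b₀` at infinity, and is holomorphic on the open set
  `{R < ‖u‖}` (`Continuity.differentiableAt_coord`), which contains every level set `{q = t}` with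
  `‖t‖ > R` (`‖u‖ ≥ |Q ∘ u|`).
* (`FarMemberFlat.forall_ne`) such a `q` omits every value `t ≠ b₀` whose level set lies in the
  region of holomorphy: the level set is finite (closed, bounded by the limit at infinity, and
  discrete by the identity theorem — a clopen argument adapted from
  `LimitCrossings.not_eventually_eq_const`), so on a large circle `q - t` is uniformly close to the
  constant `b₀ - t ≠ 0` and has winding number `0` (Rouché for loops, `wind_eq_of_norm_sub_lt`),
  whereas one zero inside would make the winding number non-zero by the generalised argument
  principle `helper_generalisedArgumentPrinciple`.
* Hence every value of `q` has modulus `≤ R` or equals `b₀`; by the intermediate value theorem for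
  `‖q‖` and the limit `q → b₀`, `q ≡ b₀` (`FarMemberFlat.eq_const_of_omits`).
* So `‖u‖ ≥ ‖b₀‖ > R` everywhere, `p := P ∘ u` is entire, and `p - id → 0` at infinity forces
  `p = id` (Liouville, `FarMemberFlat.eq_zero_of_tendsto`); the frame identities give
  `u ξ = eP ξ + eQ b₀` (`PencilDefs.eq_of_apply_eq`).

References: M. Gromov, Invent. Math. 82 (1985), §2.4.A (the `A`-spheres through a point at
infinity); the winding number API of `Literature/Topology/PlaneTopology/WindingNumber.lean`.
-/

set_option linter.dupNamespace false

noncomputable section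

open scoped ContDiff Topology
open Filter Set Metric Literature.Geometry.Symplectic
open Literature.Topology.PlaneTopology

namespace Summit.SmoothPoincare4.SmoothPoincare4.Cruxes.TameOrBrodyR4.Sketch

/-- Local notation for the model space `ℝ⁴ = EuclideanSpace ℝ (Fin 4)`. -/
local notation "E4" => EuclideanSpace ℝ (Fin 4)

namespace FarMemberFlat

/-- **No local constancy.** A continuous `q : ℂ → ℂ`, holomorphic on an open set `S` containing
the level set `{q = t}`, with `q → b₀ ≠ t` at infinity, is not eventually equal to `t` near any
point: the set of points near which `q ≡ t` is open, closed (identity theorem on a small disc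
around a limit point, which lies in the level set and hence in `S`) and, if nonempty, all of `ℂ`;
but `q ≡ t` contradicts `q → b₀`. (Adapted from `LimitCrossings.not_eventually_eq_const`.) -/
theorem not_eventually_eq {q : ℂ → ℂ} {S : Set ℂ} {b₀ t : ℂ} (hqc : Continuous q)
    (hS : IsOpen S) (hqd : DifferentiableOn ℂ q S) (htS : ∀ ξ, q ξ = t → ξ ∈ S)
    (hlim : Tendsto q (cocompact ℂ) (𝓝 b₀)) (htb : t ≠ b₀) (ξ₀ : ℂ) :
    ¬ ∀ᶠ η in 𝓝 ξ₀, q η = t := by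
  intro hξ₀
  have han : AnalyticOnNhd ℂ q S := hqd.analyticOnNhd hS
  -- the set of points near which `q ≡ t` is clopen and nonempty, hence everything
  have hAopen : IsOpen {ξ : ℂ | ∀ᶠ η in 𝓝 ξ, q η = t} := isOpen_setOf_eventually_nhds
  have hAclosed : IsClosed {ξ : ℂ | ∀ᶠ η in 𝓝 ξ, q η = t} := by
    refine isClosed_of_closure_subset fun ξ hξ => ?_
    have hξt : q ξ = t := by
      have hsub : {ξ : ℂ | ∀ᶠ η in 𝓝 ξ, q η = t} ⊆ {η | q η = t} := fun η hη => hη.self_of_nhds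
      exact ((isClosed_eq hqc continuous_const).closure_subset_iff.2 hsub) hξ
    obtain ⟨ε, hε, hball⟩ := Metric.isOpen_iff.1 hS ξ (htS ξ hξt)
    obtain ⟨η, hηball, hηA⟩ := mem_closure_iff_nhds.1 hξ (ball ξ ε) (ball_mem_nhds ξ hε)
    have heq : EqOn q (fun _ => t) (ball ξ ε) :=
      (han.mono hball).eqOn_of_preconnected_of_eventuallyEq analyticOnNhd_const
        (convex_ball ξ ε).isPreconnected hηball hηA
    exact eventually_of_mem (ball_mem_nhds ξ hε) fun η hη => heq hη
  have hall : ∀ ξ, q ξ = t := fun ξ => by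
    have hξA : ξ ∈ {ξ : ℂ | ∀ᶠ η in 𝓝 ξ, q η = t} :=
      (IsClopen.eq_univ ⟨hAclosed, hAopen⟩ ⟨ξ₀, hξ₀⟩).symm ▸ mem_univ ξ
    exact hξA.self_of_nhds
  -- ... so `q ≡ t` tends to `b₀ ≠ t`: impossible
  have hconst : Tendsto (fun _ : ℂ => t) (cocompact ℂ) (𝓝 b₀) := hlim.congr hall
  exact htb (tendsto_const_nhds_iff.mp hconst)

/-- **Isolated level points.** In the setting of `not_eventually_eq`, every point of the level set
`{q = t}` is isolated in it. -/
theorem eventually_ne {q : ℂ → ℂ} {S : Set ℂ} {b₀ t : ℂ} (hqc : Continuous q)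
    (hS : IsOpen S) (hqd : DifferentiableOn ℂ q S) (htS : ∀ ξ, q ξ = t → ξ ∈ S)
    (hlim : Tendsto q (cocompact ℂ) (𝓝 b₀)) (htb : t ≠ b₀) {ξ : ℂ} (hξ : q ξ = t) :
    ∀ᶠ z in 𝓝[≠] ξ, q z ≠ t := by
  have han : AnalyticAt ℂ (fun z => q z - t) ξ :=
    ((hqd.analyticOnNhd hS) ξ (htS ξ hξ)).sub analyticAt_const
  rcases han.eventually_eq_zero_or_eventually_ne_zero with h | h
  · exact absurd (h.mono fun z hz => sub_eq_zero.1 hz)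
      (not_eventually_eq hqc hS hqd htS hlim htb ξ)
  · exact h.mono fun z hz => sub_ne_zero.1 hz

/-- **A tail radius.** In the setting of `not_eventually_eq` there is `r₀` with
`‖q ξ - b₀‖ < ‖t - b₀‖` for `‖ξ‖ ≥ r₀`; in particular the level set `{q = t}` lies in
`‖ξ‖ < r₀`. -/
theorem exists_tail_radius {q : ℂ → ℂ} {b₀ t : ℂ} (hlim : Tendsto q (cocompact ℂ) (𝓝 b₀))
    (htb : t ≠ b₀) : ∃ r₀ : ℝ, ∀ ξ : ℂ, r₀ ≤ ‖ξ‖ → ‖q ξ - b₀‖ < ‖t - b₀‖ := by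
  have hε : 0 < ‖t - b₀‖ := norm_pos_iff.mpr (sub_ne_zero.mpr htb)
  have hev : ∀ᶠ ξ in cocompact ℂ, ‖q ξ - b₀‖ < ‖t - b₀‖ := by
    have h1 := (Metric.tendsto_nhds.mp hlim) ‖t - b₀‖ hε
    simpa only [dist_eq_norm] using h1
  rw [Filter.eventually_iff, Filter.mem_cocompact] at hev
  obtain ⟨K, hK, hKs⟩ := hev
  obtain ⟨r, hr⟩ := hK.isBounded.subset_closedBall 0
  refine ⟨r + 1, fun ξ hξ => ?_⟩
  have hξK : ξ ∉ K := fun hξK => by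
    have h1 := mem_closedBall_zero_iff.mp (hr hξK)
    linarith
  exact hKs hξK

/-- **Finiteness of the level set.** In the setting of `not_eventually_eq` the level set `{q = t}`
is finite: it is closed, bounded (by the tail radius) and consists of isolated points. -/
theorem finite_level {q : ℂ → ℂ} {S : Set ℂ} {b₀ t : ℂ} (hqc : Continuous q)
    (hS : IsOpen S) (hqd : DifferentiableOn ℂ q S) (htS : ∀ ξ, q ξ = t → ξ ∈ S)
    (hlim : Tendsto q (cocompact ℂ) (𝓝 b₀)) (htb : t ≠ b₀) : {ξ : ℂ | q ξ = t}.Finite := by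
  obtain ⟨r₀, hr₀⟩ := exists_tail_radius hlim htb
  have hZK : {ξ : ℂ | q ξ = t} ⊆ closedBall (0 : ℂ) r₀ := fun ξ hξ => by
    rw [mem_closedBall_zero_iff]
    by_contra hlt
    have h1 := hr₀ ξ (not_le.mp hlt).le
    rw [show q ξ = t from hξ] at h1
    exact lt_irrefl _ h1
  by_contra hinf
  obtain ⟨x, -, hx⟩ := (Set.not_finite.mp hinf : Set.Infinite _).exists_accPt_of_subset_isCompact
    (isCompact_closedBall (0 : ℂ) r₀) hZK
  rw [accPt_iff_frequently_nhdsNE] at hx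
  -- `x` lies in the closed level set ...
  have hxt : q x = t := by
    have hcl : x ∈ closure {ξ : ℂ | q ξ = t} :=
      mem_closure_iff_frequently.mpr (hx.filter_mono nhdsWithin_le_nhds)
    exact (isClosed_eq hqc continuous_const).closure_subset hcl
  -- ... and is isolated in it
  exact hx (eventually_ne hqc hS hqd htS hlim htb hxt)

/-- **No far values other than the limit.** A continuous `q : ℂ → ℂ`, holomorphic on an open set
`S` containing the level set `{q = t}`, with `q → b₀ ≠ t` at infinity, omits the value `t`:
otherwise, on a large circle `‖ξ‖ = ρ` enclosing the (finite) level set, `q - t` is uniformly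
close to the constant `b₀ - t ≠ 0`, so its winding number is `0` (Rouché for loops), whereas the
generalised argument principle makes it non-zero. -/
theorem forall_ne {q : ℂ → ℂ} {S : Set ℂ} {b₀ t : ℂ} (hqc : Continuous q)
    (hS : IsOpen S) (hqd : DifferentiableOn ℂ q S) (htS : ∀ ξ, q ξ = t → ξ ∈ S)
    (hlim : Tendsto q (cocompact ℂ) (𝓝 b₀)) (htb : t ≠ b₀) : ∀ ξ, q ξ ≠ t := by
  intro ξ₀ hξ₀
  obtain ⟨r₀, hr₀⟩ := exists_tail_radius hlim htb
  -- the radius of the big circle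
  set ρ : ℝ := max r₀ 1
  have hρ : 0 < ρ := lt_of_lt_of_le one_pos (le_max_right _ _)
  have hZρ : ∀ ξ, q ξ = t → ‖ξ‖ < ρ := fun ξ hξ => by
    by_contra hle
    have h1 := hr₀ ξ ((le_max_left _ _).trans (not_lt.mp hle))
    rw [hξ] at h1
    exact lt_irrefl _ h1
  -- Rouché against the constant loop `b₀ - t`
  have hw0 : wind (fun s => q (circleLoop 0 ρ s) - t) = 0 := by
    rw [← wind_const (b₀ - t)]
    refine wind_eq_of_norm_sub_lt
      ((hqc.comp (continuous_circleLoop 0 ρ)).sub continuous_const).continuousOn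
      (by rw [circleLoop_zero_eq]) (IsNonvanishingLoop.const (sub_ne_zero.mpr htb.symm))
      fun s _ => ?_
    have h1 : ‖circleLoop 0 ρ s‖ = ρ := by simpa using circleLoop_mem_sphere 0 hρ.le s
    have h2 := hr₀ (circleLoop 0 ρ s) (by rw [h1]; exact le_max_left _ _)
    calc ‖q (circleLoop 0 ρ s) - t - (b₀ - t)‖ = ‖q (circleLoop 0 ρ s) - b₀‖ := by
          congr 1; ring
      _ < ‖t - b₀‖ := h2
      _ = ‖b₀ - t‖ := norm_sub_rev _ _
  -- the generalised argument principle
  have hw1 : wind (fun s => q (circleLoop 0 ρ s) - t) ≠ 0 := by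
    refine helper_generalisedArgumentPrinciple (fun ξ => q ξ - t) ρ hρ
      (hqc.sub continuous_const).continuousOn ?_ ?_
      ⟨ξ₀, mem_closedBall_zero_iff.mpr (hZρ ξ₀ hξ₀).le, sub_eq_zero.mpr hξ₀⟩
    · exact (finite_level hqc hS hqd htS hlim htb).subset fun z hz => sub_eq_zero.mp hz.2
    · intro z _ hz
      have hzt : q z = t := sub_eq_zero.mp hz
      exact ⟨hZρ z hzt, S, hS.mem_nhds (htS z hzt), hqd.sub (differentiableOn_const t)⟩
  exact hw1 hw0

/-- **Constancy from omitted values.** A continuous `q : ℂ → ℂ` with `q → b₀` at infinity,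
`‖b₀‖ > R`, all of whose values `w` satisfy `‖w‖ ≤ R` or `w = b₀`, is identically `b₀`
(intermediate values of `‖q‖`). -/
theorem eq_const_of_omits {q : ℂ → ℂ} {b₀ : ℂ} {R : ℝ} (hqc : Continuous q)
    (hlim : Tendsto q (cocompact ℂ) (𝓝 b₀)) (hb₀ : R < ‖b₀‖)
    (hfar : ∀ ξ, R < ‖q ξ‖ → q ξ = b₀) : ∀ ξ, q ξ = b₀ := by
  -- a point where `q = b₀`
  obtain ⟨ξ₁, hξ₁⟩ : ∃ ξ₁, q ξ₁ = b₀ := by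
    have hev : ∀ᶠ ξ in cocompact ℂ, ‖q ξ - b₀‖ < ‖b₀‖ - R := by
      have h1 := (Metric.tendsto_nhds.mp hlim) (‖b₀‖ - R) (by linarith)
      simpa only [dist_eq_norm] using h1
    obtain ⟨ξ₁, hξ₁⟩ := hev.exists
    refine ⟨ξ₁, hfar ξ₁ ?_⟩
    have h2 := norm_sub_norm_le b₀ (q ξ₁)
    rw [norm_sub_rev] at h2
    linarith
  intro ξ
  by_contra hne
  have hle : ‖q ξ‖ ≤ R := not_lt.mp fun hlt => hne (hfar ξ hlt)
  -- an intermediate value of `‖q‖` strictly between `R` and `‖b₀‖`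
  have hc : (R + ‖b₀‖) / 2 ∈ Icc ‖q ξ‖ ‖q ξ₁‖ := by
    rw [hξ₁]
    constructor <;> linarith
  obtain ⟨ξ₃, hξ₃⟩ := Set.mem_range.mp (intermediate_value_univ ξ ξ₁ hqc.norm hc)
  have hξ₃' : ‖q ξ₃‖ = (R + ‖b₀‖) / 2 := hξ₃
  have h3 := hfar ξ₃ (by rw [hξ₃']; linarith)
  rw [h3] at hξ₃'
  linarith

/-- **Liouville with decay.** An entire function tending to `0` at infinity vanishes
identically. -/
theorem eq_zero_of_tendsto {e : ℂ → ℂ} (hed : Differentiable ℂ e)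
    (hlim : Tendsto e (cocompact ℂ) (𝓝 0)) : ∀ ξ, e ξ = 0 := by
  obtain ⟨M, hM⟩ := Continuity.exists_bound_of_tendsto_zero hed.continuous hlim
  have hbdd : Bornology.IsBounded (range e) := by
    refine (isBounded_closedBall (x := (0 : ℂ)) (r := M)).subset ?_
    rintro _ ⟨ξ, rfl⟩
    exact mem_closedBall_zero_iff.mpr (hM ξ)
  have hconst : ∀ ξ, e ξ = e 0 := fun ξ => hed.apply_eq_apply_of_bounded hbdd ξ 0
  have hc0 : e 0 = 0 := tendsto_const_nhds_iff.mp (hlim.congr hconst)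
  intro ξ
  rw [hconst ξ, hc0]

end FarMemberFlat

/-- (FF) far members are flat: a normalised member whose asymptotic value `b₀` has `|b₀| > R`
is the flat plane `{Q = b₀}` in its linear parametrisation. -/
theorem helper_farMemberFlat (J : E4 → E4 →L[ℝ] E4) (R : ℝ) (P Q : E4 →L[ℝ] ℂ)
    (eP eQ : ℂ →L[ℝ] E4) (hR : 0 < R) (hPQ : IsCoordFrame P Q eP eQ)
    (hJP : ∀ x : E4, R ≤ ‖x‖ → ∀ v, P (J x v) = Complex.I * P v)
    (hJQ : ∀ x : E4, R ≤ ‖x‖ → ∀ v, Q (J x v) = Complex.I * Q v)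
    (b₀ : ℂ) (hb₀ : R < ‖b₀‖) (u : ℂ → E4) (hu : IsPencilMember J R P Q b₀ u) :
    u = fun ξ => eP ξ + eQ b₀ := by
  -- `hR` is not needed below (only `R < ‖b₀‖` matters)
  have _ : 0 < R := hR
  obtain ⟨hus, huJ, -, -, hQlim, hPlim, -, -⟩ := hu
  have hqc : Continuous fun ξ => Q (u ξ) := Q.continuous.comp hus.continuous
  -- holomorphy of `Q ∘ u` on the open set `{R < ‖u‖}`, which contains every far level set
  have hΩ : IsOpen {ξ : ℂ | R < ‖u ξ‖} := isOpen_lt continuous_const hus.continuous.norm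
  have hqd : DifferentiableOn ℂ (fun ξ => Q (u ξ)) {ξ : ℂ | R < ‖u ξ‖} := fun ξ hξ =>
    (Continuity.differentiableAt_coord Q hJQ hus huJ (le_of_lt hξ)).differentiableWithinAt
  -- `Q ∘ u` omits every far value other than `b₀` ...
  have hfar : ∀ ξ, R < ‖Q (u ξ)‖ → Q (u ξ) = b₀ := fun ξ hξ => by
    by_contra hne
    refine FarMemberFlat.forall_ne hqc hΩ hqd (fun η hη => ?_) hQlim hne ξ rfl
    show R < ‖u η‖
    calc R < ‖Q (u ξ)‖ := hξ
      _ = ‖Q (u η)‖ := by rw [hη]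
      _ ≤ ‖u η‖ := PencilDefs.norm_Q_le hPQ _
  -- ... hence is identically `b₀`
  have hqb : ∀ ξ, Q (u ξ) = b₀ := FarMemberFlat.eq_const_of_omits hqc hQlim hb₀ hfar
  -- so `u` stays in the standard region and `P ∘ u` is entire; Liouville for `P ∘ u - id`
  have hfarR : ∀ ξ, R ≤ ‖u ξ‖ := fun ξ =>
    calc R ≤ ‖b₀‖ := hb₀.le
      _ = ‖Q (u ξ)‖ := by rw [hqb ξ]
      _ ≤ ‖u ξ‖ := PencilDefs.norm_Q_le hPQ _
  have hpd : Differentiable ℂ fun ξ => P (u ξ) := fun ξ =>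
    Continuity.differentiableAt_coord P hJP hus huJ (hfarR ξ)
  have hp : ∀ ξ, P (u ξ) = ξ := fun ξ =>
    sub_eq_zero.mp (FarMemberFlat.eq_zero_of_tendsto (hpd.sub differentiable_id) hPlim ξ)
  -- comparison of coordinates
  obtain ⟨-, hPeP, hQeP, hPeQ, hQeQ, -⟩ := id hPQ
  funext ξ
  refine PencilDefs.eq_of_apply_eq hPQ ?_ ?_
  · rw [map_add, hPeP, hPeQ, add_zero, hp]
  · rw [map_add, hQeP, hQeQ, zero_add, hqb]

end Summit.SmoothPoincare4.SmoothPoincare4.Cruxes.TameOrBrodyR4.Sketch
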